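import Summits.HodgeConjecture.CorCM.DecicWeil23PairPowersHodgeOfMarkman
import Summits.HodgeConjecture.CorCM.OcticCurveFourfoldHodgeOfMarkman
import HarnessLib

/-!
# COR-CM — the Hodge conjecture for every product of copies of `E`, `B₁`, `B₂` — TWO CM abelian fivefolds with CM by one DECIC
# field `K ⊇ i(k)`, of `k`-signature `(2,3)` and DIFFERENT types, and the CM curve of `k` — GIVEN ONLY Markman's hyperbolic-
# sixfold theorem and `3`-transitivity of `Aut(ℂ/k)` on the five embeddings over `τ` (intrinsic form)

Cell `pub-hodgecm2` (COR-CM), seat b30 gen 22 (2026-08-22); count-neutral own lane DECIC-WEIL-23PAIR.  Theorems only; no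
definition, no named fact, no `sorry`.  HONEST FRAMING: CONDITIONAL on the single displayed named fact
`HodgeTheory.Markman2025_weilClasses_algebraic_hyperbolicSixfold` (arXiv:2502.03415 Thm 1.5.1, unrefereed); `HC_CM` is not
asserted and no case of the Hodge conjecture is claimed unconditionally.

* §1 THE FRAME: `exists_frame₅` (for `[K:ℚ] = 10`, `i : k → K`, `Hom(k,ℂ) = {τ, τ̄}`: an enumeration `e : Hom(K, ℂ) ≃ Fin 5 × Bool`
  with `(e s).2 = [s ∘ i = τ]`, `e s̄ = ((e s).1, ¬(e s).2)`), the reading of a CM type through its set of `τ`-positions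
  (`mem_iff_of_reading₅`), the NORMAL FORM of two distinct `2`-subsets of `Fin 5` under the alternating group (`exists_row_normalForm`,
  `decide`: `I_0 = {0,1}` and `I_1 = {1,2}` or `{3,2}`), and **`exists_frameD`** — two distinct `(2,3)`-types are read at the
  normal positions in a suitable frame; `h3t_of_threeTransitive` — the intrinsic `3`-transitivity gives the frame form `h3t`.
* §2 **`hodgeConjectureFor_biproduct_comp_vec_of_markmanD`** — `K ⊇ i(k)` a CM field of degree `10`, `k` imaginary quadratic,
  `B₁ ⊨ (K; Φ₁)`, `B₂ ⊨ (K; Φ₂)` with `#{s ∈ Φ_m | s ∘ i = τ} = 2` (`k`-signature `(2,3)`: CM abelian FIVEFOLDS) and `Φ₁ ≠ Φ₂`,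
  `E ⊨ (k; Ψ ∋ τ)`, and `Aut(ℂ/k)` `3`-TRANSITIVE on the five embeddings of `K` over `τ` (the totally real quintic `K⁺` has
  Galois group `A₅` or `S₅` — the generic case): for every `κ : Fin N → Fin 3` the Hodge conjecture holds for
  `⨁_j ![E, B₁, B₂](κ j)`, i.e. for EVERY `E^a × B₁^{n₁} × B₂^{n₂}`; with the `AVDominatedBy` form (isogeny factors, quotients,
  abelian subvarieties).  The new input over seat b09's `DecicCurveFivefold*` (ONE fivefold, cyclic `K`) is the TENFOLD Weil
  class of `B₁ × B̄₂`, reached by PUSH-PULL through two fresh curves.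
RECORDED, NOT CLAIMED (exact census `Census/DecicWeil23Pair`): three distinct `(2,3)`-types are still clean, four are clean off
the `25` «triangle + complement» configurations, five or more never (rank bound `17 = 1 + 4²`).
[cite: Markman2025SecantWeil, Thm 1.5.1] [cite: Pohlmann1968, Thm 1] [cite: Shimura1998, §18.2 Lemma (i)]
[cite: Deligne1982HodgeCycles, §4 Prop. 4.4 and §5 (c)] [cite: Schoen1998HodgeWeilAddendum, §10] [cite: DixonMortimer1996, Thm 7.6A]

## References
* [Markman2025SecantWeil] E. Markman, arXiv:2502.03415 (unrefereed), Thm 1.5.1.  [Pohlmann1968] H. Pohlmann, Ann. of Math. 88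
  (1968), Thm 1.  [Shimura1998] G. Shimura, *Abelian varieties with CM and modular functions*, §18.2 Lemma (i).
  [Deligne1982HodgeCycles] P. Deligne, LNM 900 (1982), §4 Prop. 4.4, §5 (c).  [Schoen1998HodgeWeilAddendum] C. Schoen,
  Compositio Math. 114 (1998), §10.  [DixonMortimer1996] J. D. Dixon, B. Mortimer, *Permutation Groups*, GTM 163, Thm 7.6A.
  [MumfordAV1970] D. Mumford, *Abelian Varieties*, §19.
-/

noncomputable section

open CategoryTheory CategoryTheory.Limits NumberField

namespace Summit.HodgeConjecture.CorCM.DecicWeil23Pair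

open Literature.AlgebraicGeometry Literature.AlgebraicGeometry.Motives Literature.AlgebraicGeometry.HodgeTheory
open Literature.AlgebraicGeometry.ComplexMultiplication (IsCMTypeRealisation)
open Literature.AlgebraicTopology.SingularHomology
open Summit.HodgeConjecture.CorCM.Census.DecicWeil23Pair (permD permD_facts inPos signTabD)
open Summit.HodgeConjecture.CorCM.DecicCurveFivefold (card_filter_comp_eq_five)
open Summit.HodgeConjecture.CorCM.OcticCurveFourfold (exists_delta_of_mem)
open Summit.HodgeConjecture.CorCM.NonGaloisField (conjugate_comp)

open scoped Classical

/-! ## §1 The frame -/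

section Frame

variable {K : Type} [Field K] [NumberField K] {k : Type} [Field k] [NumberField k]

/-- **THE FRAME EXISTS.**  For `[K:ℚ] = 10`, `i : k → K`, `Hom(k, ℂ) = {τ, τ̄}` there is an enumeration `e : Hom(K, ℂ) ≃ Fin 5 × Bool`
with `(e s).2 = [s ∘ i = τ]` and `e s̄ = ((e s).1, ¬(e s).2)`: number the five embeddings over `τ` and give `s̄` the number of `s`.
[cite: Shimura1998, §18.2 Lemma (i)] -/
theorem exists_frame₅ (h10 : Module.finrank ℚ K = 10) (h2 : Module.finrank ℚ k = 2) (i : k →+* K) {τ : k →+* ℂ}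
    (hττ : ComplexEmbedding.conjugate τ ≠ τ) (hk : ∀ σ : k →+* ℂ, σ = τ ∨ σ = ComplexEmbedding.conjugate τ) :
    ∃ e : (K →+* ℂ) ≃ Fin 5 × Bool, (∀ s, (e s).2 = true ↔ s.comp i = τ) ∧
      ∀ s, e (ComplexEmbedding.conjugate s) = ((e s).1, !(e s).2) := by
  -- the five embeddings over `τ`
  set F : Finset (K →+* ℂ) := Finset.univ.filter fun s : K →+* ℂ => s.comp i = τ with hFdef
  have hF : F.card = 5 := card_filter_comp_eq_five i h10 h2 τ
  let g : {s // s ∈ F} ≃ Fin 5 := F.equivFinOfCardEq hF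
  have hmemF : ∀ s : K →+* ℂ, s ∈ F ↔ s.comp i = τ := fun s => by simp [hFdef]
  -- over `τ̄` the conjugate lies over `τ`
  have hconj_over : ∀ s : K →+* ℂ, ¬ s.comp i = τ → (ComplexEmbedding.conjugate s).comp i = τ := by
    intro s hs
    rw [conjugate_comp, (hk (s.comp i)).resolve_left hs, ComplexEmbedding.involutive_conjugate]
  have hconj_over' : ∀ s : K →+* ℂ, s.comp i = τ → ¬ (ComplexEmbedding.conjugate s).comp i = τ := by
    intro s hs h
    rw [conjugate_comp, hs] at h
    exact hττ h
  -- the enumeration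
  let toF : (K →+* ℂ) → Fin 5 × Bool := fun s =>
    if h : s.comp i = τ then (g ⟨s, (hmemF s).2 h⟩, true)
    else (g ⟨ComplexEmbedding.conjugate s, (hmemF _).2 (hconj_over s h)⟩, false)
  let ofF : Fin 5 × Bool → (K →+* ℂ) := fun p =>
    if p.2 then (g.symm p.1).1 else ComplexEmbedding.conjugate (g.symm p.1).1
  have hgF : ∀ a : Fin 5, ((g.symm a).1).comp i = τ := fun a => (hmemF _).1 (g.symm a).2
  have hcc : ∀ s : K →+* ℂ, ComplexEmbedding.conjugate (ComplexEmbedding.conjugate s) = s :=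
    ComplexEmbedding.involutive_conjugate K
  have hgcongr : ∀ (s t : K →+* ℂ) (hs : s ∈ F) (ht : t ∈ F), s = t → g ⟨s, hs⟩ = g ⟨t, ht⟩ := by
    rintro s t hs ht rfl; rfl
  have htoF_pos : ∀ s (h : s.comp i = τ), toF s = (g ⟨s, (hmemF s).2 h⟩, true) := fun s h => dif_pos h
  have htoF_neg : ∀ s (h : ¬ s.comp i = τ),
      toF s = (g ⟨ComplexEmbedding.conjugate s, (hmemF _).2 (hconj_over s h)⟩, false) := fun s h => dif_neg h
  have htoF_of : ∀ p, toF (ofF p) = p := by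
    rintro ⟨a, b⟩
    cases b
    · have hof : ofF (a, false) = ComplexEmbedding.conjugate (g.symm a).1 := rfl
      have h : ¬ (ComplexEmbedding.conjugate (g.symm a).1).comp i = τ := hconj_over' _ (hgF a)
      rw [hof, htoF_neg _ h, Prod.mk.injEq]
      refine ⟨?_, rfl⟩
      rw [hgcongr _ _ _ (g.symm a).2 (hcc _), Subtype.coe_eta, Equiv.apply_symm_apply]
    · have hof : ofF (a, true) = (g.symm a).1 := rfl
      rw [hof, htoF_pos _ (hgF a), Prod.mk.injEq]
      exact ⟨by rw [Subtype.coe_eta, Equiv.apply_symm_apply], rfl⟩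
  have hof_toF : ∀ s, ofF (toF s) = s := by
    intro s
    by_cases h : s.comp i = τ
    · rw [htoF_pos s h]
      change (g.symm (g ⟨s, _⟩)).1 = s
      rw [Equiv.symm_apply_apply]
    · rw [htoF_neg s h]
      change ComplexEmbedding.conjugate (g.symm (g ⟨ComplexEmbedding.conjugate s, _⟩)).1 = s
      rw [Equiv.symm_apply_apply]
      exact hcc s
  let e : (K →+* ℂ) ≃ Fin 5 × Bool := ⟨toF, ofF, hof_toF, htoF_of⟩
  have he : ∀ s, e s = toF s := fun _ => rfl
  refine ⟨e, fun s => ?_, fun s => ?_⟩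
  · -- signs
    rw [he]
    by_cases h : s.comp i = τ
    · rw [htoF_pos s h]; exact ⟨fun _ => h, fun _ => rfl⟩
    · rw [htoF_neg s h]; exact ⟨fun h' => absurd h' Bool.false_ne_true, fun h' => absurd h' h⟩
  · -- conjugation
    rw [he, he]
    by_cases h : s.comp i = τ
    · have h' : ¬ (ComplexEmbedding.conjugate s).comp i = τ := hconj_over' s h
      rw [htoF_pos s h, htoF_neg _ h', Prod.mk.injEq]
      exact ⟨hgcongr _ _ _ _ (hcc s), rfl⟩
    · have h' : (ComplexEmbedding.conjugate s).comp i = τ := hconj_over s h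
      rw [htoF_neg s h, htoF_pos _ h']
      rfl

omit [NumberField k] in
/-- Counting through the frame: for a property `P` of embeddings, the labels `a` with `P (e⁻¹(a, true))` are as many as the
embeddings over `τ` with `P`. [folklore] -/
theorem card_filter_symm_true₅ {e : (K →+* ℂ) ≃ Fin 5 × Bool} {i : k →+* K} {τ : k →+* ℂ}
    (he_sign : ∀ s, (e s).2 = true ↔ s.comp i = τ) (P : (K →+* ℂ) → Prop) :
    (Finset.univ.filter fun a : Fin 5 => P (e.symm (a, true))).card =
      (Finset.univ.filter fun s : K →+* ℂ => s.comp i = τ ∧ P s).card := by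
  refine Finset.card_bij (fun a _ => e.symm (a, true)) (fun a ha => ?_) (fun a _ b _ h => ?_) fun s hs => ?_
  · exact Finset.mem_filter.2 ⟨Finset.mem_univ _, (he_sign _).1 (by rw [Equiv.apply_symm_apply]),
      (Finset.mem_filter.1 ha).2⟩
  · exact (Prod.mk.inj (e.symm.injective h)).1
  · obtain ⟨-, hsτ, hP⟩ := Finset.mem_filter.1 hs
    have hs' : e.symm ((e s).1, true) = s := by
      rw [show ((e s).1, true) = e s from Prod.ext rfl ((he_sign s).2 hsτ).symm, Equiv.symm_apply_apply]
    exact ⟨(e s).1, Finset.mem_filter.2 ⟨Finset.mem_univ _, by rw [hs']; exact hP⟩, hs'⟩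

omit [NumberField K] [NumberField k] in
/-- **The type from its reading on the labels `(a, true)`**: if `e⁻¹(a, true) ∈ Φ ⟺ P a` then `s ∈ Φ ⟺ (e s).2 = P (e s).1`
(over `τ̄` read the conjugate: a CM type contains exactly one of `s, s̄`). [cite: Shimura1998, §18.2 Lemma (i)] -/
theorem mem_iff_of_reading₅ {e : (K →+* ℂ) ≃ Fin 5 × Bool}
    (he_conj : ∀ s, e (ComplexEmbedding.conjugate s) = ((e s).1, !(e s).2)) {Φ : CMType K} {P : Fin 5 → Bool}
    (hP : ∀ a : Fin 5, e.symm (a, true) ∈ Φ.1 ↔ P a = true) (s : K →+* ℂ) :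
    s ∈ Φ.1 ↔ (e s).2 = P (e s).1 := by
  have key := hP (e s).1
  cases h2s : (e s).2
  · -- `s` lies over `τ̄`: read its conjugate, which is `e⁻¹((e s).1, true)`
    have hs : ComplexEmbedding.conjugate s = e.symm ((e s).1, true) := by
      apply e.injective
      rw [he_conj, Equiv.apply_symm_apply, h2s]
      rfl
    rw [← hs] at key
    rw [Φ.2 s, key]
    cases P (e s).1 <;> simp
  · have hs : s = e.symm ((e s).1, true) := by
      apply e.injective
      rw [Equiv.apply_symm_apply]
      exact Prod.ext rfl h2s
    rw [← hs] at key
    rw [key]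
    cases P (e s).1 <;> simp

/-- **The normal form under the alternating group**: two distinct `2`-subsets `{a₀, b₀} ≠ {a₁, b₁}` of the five pairs are carried by
one of the sixty EVEN permutations `permD r` onto `I_0 = {0,1}` and `I_1 = {1,2}` (`c = true`, if they meet) or `{3,2}` (`c = false`,
if they are disjoint): `a ∈ J_m ⟺ signTabD c r m a` (`= [permD r a ∈ I_m]`). [folklore] -/
theorem exists_row_normalForm : ∀ (a₀ b₀ a₁ b₁ : Fin 5), a₀ ≠ b₀ → a₁ ≠ b₁ → ¬ (a₀ = a₁ ∧ b₀ = b₁) → ¬ (a₀ = b₁ ∧ b₀ = a₁) →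
    ∃ (r : Fin 60) (c : Bool), ∀ a : Fin 5, ((a = a₀ ∨ a = b₀) ↔ signTabD c r 0 a = true) ∧
      ((a = a₁ ∨ a = b₁) ↔ signTabD c r 1 a = true) := by
  unfold signTabD inPos permD
  decide +kernel

/-- **THE FRAME EXISTS (normal form).**  For `[K:ℚ] = 10`, `i : k → K`, `Hom(k, ℂ) = {τ, τ̄}`, and two DISTINCT CM types `Φ₁ ≠ Φ₂`
of `K` with two members over `τ` each: an enumeration `e` with `(e s).2 = [s ∘ i = τ]`, `e s̄ = ((e s).1, ¬(e s).2)` reading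
`Φ₁` at the positions `I_0 = {0,1}` and `Φ₂` at `I_1` (`= {1,2}` or `{3,2}` according to `c`): `s ∈ Φ_{m+1} ⟺ (e s).2 = inPos c m (e s).1`.
[cite: Shimura1998, §18.2 Lemma (i)] -/
theorem exists_frameD (h10 : Module.finrank ℚ K = 10) (h2 : Module.finrank ℚ k = 2) (i : k →+* K) {τ : k →+* ℂ}
    (hττ : ComplexEmbedding.conjugate τ ≠ τ) (hk : ∀ σ : k →+* ℂ, σ = τ ∨ σ = ComplexEmbedding.conjugate τ)
    (Φ₁ Φ₂ : CMType K) (h₁ : (Finset.univ.filter fun s : K →+* ℂ => s.comp i = τ ∧ s ∈ Φ₁.1).card = 2)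
    (h₂ : (Finset.univ.filter fun s : K →+* ℂ => s.comp i = τ ∧ s ∈ Φ₂.1).card = 2) (hne : Φ₁ ≠ Φ₂) :
    ∃ (e : (K →+* ℂ) ≃ Fin 5 × Bool) (c : Bool), (∀ s, (e s).2 = true ↔ s.comp i = τ) ∧
      (∀ s, e (ComplexEmbedding.conjugate s) = ((e s).1, !(e s).2)) ∧
      (∀ s, s ∈ Φ₁.1 ↔ (e s).2 = inPos c 0 (e s).1) ∧ (∀ s, s ∈ Φ₂.1 ↔ (e s).2 = inPos c 1 (e s).1) := by
  obtain ⟨e₀, he₀_sign, he₀_conj⟩ := exists_frame₅ h10 h2 i hττ hk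
  -- the position sets
  set J₀ : Finset (Fin 5) := Finset.univ.filter fun a => e₀.symm (a, true) ∈ Φ₁.1 with hJ₀
  set J₁ : Finset (Fin 5) := Finset.univ.filter fun a => e₀.symm (a, true) ∈ Φ₂.1 with hJ₁
  have hJ₀card : J₀.card = 2 := by rw [hJ₀, card_filter_symm_true₅ he₀_sign (fun s => s ∈ Φ₁.1)]; exact h₁
  have hJ₁card : J₁.card = 2 := by rw [hJ₁, card_filter_symm_true₅ he₀_sign (fun s => s ∈ Φ₂.1)]; exact h₂
  have hr₀ : ∀ s, s ∈ Φ₁.1 ↔ (e₀ s).2 = decide ((e₀ s).1 ∈ J₀) :=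
    mem_iff_of_reading₅ (Φ := Φ₁) (P := fun a => decide (a ∈ J₀)) he₀_conj fun a => by simp [hJ₀]
  have hr₁ : ∀ s, s ∈ Φ₂.1 ↔ (e₀ s).2 = decide ((e₀ s).1 ∈ J₁) :=
    mem_iff_of_reading₅ (Φ := Φ₂) (P := fun a => decide (a ∈ J₁)) he₀_conj fun a => by simp [hJ₁]
  have hJne : J₀ ≠ J₁ := by
    intro hJ
    apply hne
    refine Subtype.ext (Set.ext fun s => ?_)
    change s ∈ Φ₁.1 ↔ s ∈ Φ₂.1
    rw [hr₀, hr₁, hJ]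
  obtain ⟨a₀, b₀, hab₀, hJ₀eq⟩ := Finset.card_eq_two.1 hJ₀card
  obtain ⟨a₁, b₁, hab₁, hJ₁eq⟩ := Finset.card_eq_two.1 hJ₁card
  have hne₁ : ¬ (a₀ = a₁ ∧ b₀ = b₁) := by
    rintro ⟨rfl, rfl⟩; exact hJne (hJ₀eq.trans hJ₁eq.symm)
  have hne₂ : ¬ (a₀ = b₁ ∧ b₀ = a₁) := by
    rintro ⟨rfl, rfl⟩; exact hJne (hJ₀eq.trans ((Finset.pair_comm _ _).trans hJ₁eq.symm))
  obtain ⟨r, c, hrc⟩ := exists_row_normalForm a₀ b₀ a₁ b₁ hab₀ hab₁ hne₁ hne₂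
  -- the re-numbered frame along the even permutation `permD r`
  let σ : Equiv.Perm (Fin 5) :=
    Equiv.ofBijective (permD r) (Finite.injective_iff_bijective.1 (permD_facts.1 r))
  have hσ : ∀ a, σ a = permD r a := fun _ => rfl
  let e : (K →+* ℂ) ≃ Fin 5 × Bool := e₀.trans (Equiv.prodCongr σ (Equiv.refl Bool))
  have he : ∀ s, e s = (σ (e₀ s).1, (e₀ s).2) := fun s => rfl
  have he_conj : ∀ s, e (ComplexEmbedding.conjugate s) = ((e s).1, !(e s).2) := fun s => by rw [he, he, he₀_conj]
  have hsymm : ∀ b : Fin 5, e.symm (b, true) = e₀.symm (σ.symm b, true) := fun b => rfl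
  have hread : ∀ (m : Fin 2) (J : Finset (Fin 5)) (Φ : CMType K), J = (Finset.univ.filter fun a => e₀.symm (a, true) ∈ Φ.1) →
      (∀ a, a ∈ J ↔ signTabD c r m a = true) → ∀ s, s ∈ Φ.1 ↔ (e s).2 = inPos c m (e s).1 := by
    intro m J Φ hJ hJr
    refine mem_iff_of_reading₅ (Φ := Φ) (P := inPos c m) he_conj fun b => ?_
    have h := hJr (σ.symm b)
    have hmem : e₀.symm (σ.symm b, true) ∈ Φ.1 ↔ σ.symm b ∈ J := by rw [hJ, Finset.mem_filter]; simp
    rw [hsymm, hmem, h, signTabD, ← hσ, Equiv.apply_symm_apply]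
  exact ⟨e, c, fun s => by rw [he]; exact he₀_sign s, he_conj,
    hread 0 J₀ Φ₁ hJ₀ fun a => by rw [hJ₀eq, Finset.mem_insert, Finset.mem_singleton]; exact (hrc a).1,
    hread 1 J₁ Φ₂ hJ₁ fun a => by rw [hJ₁eq, Finset.mem_insert, Finset.mem_singleton]; exact (hrc a).2⟩

omit [NumberField K] [NumberField k] in
/-- **`3`-transitivity, intrinsic ⟹ frame form**: if `Aut(ℂ)` moves every injective triple of embeddings of `K` over `τ` to every
other (`h3T`), then every ordered triple of distinct labels is moved to `(0, 1, 2)` (`h3t`). [folklore] -/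
theorem h3t_of_threeTransitive {e : (K →+* ℂ) ≃ Fin 5 × Bool} {i : k →+* K} {τ : k →+* ℂ}
    (he_sign : ∀ s, (e s).2 = true ↔ s.comp i = τ)
    (h3T : ∀ x y : Fin 3 ↪ {s : K →+* ℂ // s.comp i = τ}, ∃ ρ : ℂ ≃+* ℂ, ∀ j : Fin 3, (ρ : ℂ →+* ℂ).comp (x j).1 = (y j).1)
    (a b c : Fin 5) (hab : a ≠ b) (hac : a ≠ c) (hbc : b ≠ c) :
    ∃ ρ : ℂ ≃+* ℂ, (ρ : ℂ →+* ℂ).comp (e.symm (a, true)) = e.symm (0, true) ∧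
      (ρ : ℂ →+* ℂ).comp (e.symm (b, true)) = e.symm (1, true) ∧ (ρ : ℂ →+* ℂ).comp (e.symm (c, true)) = e.symm (2, true) := by
  have hover : ∀ a : Fin 5, (e.symm (a, true)).comp i = τ := fun a => (he_sign _).1 (by rw [Equiv.apply_symm_apply])
  -- the embedding of labelled triples into the fibre
  have hemb : ∀ a b c : Fin 5, a ≠ b → a ≠ c → b ≠ c →
      Function.Injective (![⟨e.symm (a, true), hover a⟩, ⟨e.symm (b, true), hover b⟩, ⟨e.symm (c, true), hover c⟩] :
        Fin 3 → {s : K →+* ℂ // s.comp i = τ}) := by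
    intro a b c hab hac hbc j j' h
    have key : ∀ u w : Fin 5, (⟨e.symm (u, true), hover u⟩ : {s : K →+* ℂ // s.comp i = τ}) = ⟨e.symm (w, true), hover w⟩ →
        u = w := fun u w huw => (Prod.mk.inj (e.symm.injective (congrArg Subtype.val huw))).1
    fin_cases j <;> fin_cases j'
    · rfl
    · exact absurd (key _ _ h) hab
    · exact absurd (key _ _ h) hac
    · exact absurd (key _ _ h).symm hab
    · rfl
    · exact absurd (key _ _ h) hbc
    · exact absurd (key _ _ h).symm hac
    · exact absurd (key _ _ h).symm hbc
    · rfl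
  obtain ⟨ρ, hρ⟩ := h3T ⟨_, hemb a b c hab hac hbc⟩ ⟨_, hemb 0 1 2 (by decide) (by decide) (by decide)⟩
  exact ⟨ρ, hρ 0, hρ 1, hρ 2⟩

end Frame

/-! ## §2 The intrinsic theorem -/

section Main

variable {K : Type} [Field K] [NumberField K] [IsCMField K] {k : Type} [Field k] [NumberField k] [IsCMField k] {N : ℕ}
  {Φ₁ Φ₂ : CMType K} {B₁ B₂ : AbelianVariety ℂ}
  {ι₁ : 𝓞 K →+* End B₁} {θ₁ : K →+* Module.End ℂ (complexBetti B₁.X 1)}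
  {ι₂ : 𝓞 K →+* End B₂} {θ₂ : K →+* Module.End ℂ (complexBetti B₂.X 1)}
  {Ψ : CMType k} {E : AbelianVariety ℂ} {ιE : 𝓞 k →+* End E} {θE : k →+* Module.End ℂ (complexBetti E.X 1)}

/-- **THE HODGE CONJECTURE FOR EVERY PRODUCT OF COPIES OF `E, B₁, B₂`, GIVEN ONLY Markman's hyperbolic-sixfold theorem** —
`B₁ ⊨ (K; Φ₁)` and `B₂ ⊨ (K; Φ₂)` CM abelian FIVEFOLDS with CM by one field `K ⊇ i(k)` of degree `10`, of `k`-signature `(2,3)`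
(`h23₁`, `h23₂`: two members over `τ`) and of DIFFERENT types (`hne`), `E ⊨ (k; Ψ ∋ τ)` the CM elliptic curve, and `Aut(ℂ)`
`3`-TRANSITIVE on the five embeddings of `K` over `τ` (`h3T`: the totally real quintic subfield has Galois group `A₅` or `S₅`):
for every `κ : Fin N → Fin 3`, every rational `(q,q)`-class on `⨁_j ![E, B₁, B₂] (κ j)` is algebraic.
[cite: Markman2025SecantWeil, Thm 1.5.1] [cite: Pohlmann1968, Thm 1] [cite: Deligne1982HodgeCycles, §5 (c)]
[cite: Schoen1998HodgeWeilAddendum, §10] [cite: DixonMortimer1996, Thm 7.6A] -/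
theorem hodgeConjectureFor_biproduct_comp_vec_of_markmanD
    (hM6 : Markman2025_weilClasses_algebraic_hyperbolicSixfold)
    (h10 : Module.finrank ℚ K = 10) (h2 : Module.finrank ℚ k = 2) (i : k →+* K)
    (hB₁ : IsCMTypeRealisation Φ₁ B₁ ι₁ θ₁) (hB₂ : IsCMTypeRealisation Φ₂ B₂ ι₂ θ₂) (hE : IsCMTypeRealisation Ψ E ιE θE)
    {τ : k →+* ℂ} (hτΨ : τ ∈ Ψ.1)
    (h23₁ : (Finset.univ.filter fun s : K →+* ℂ => s.comp i = τ ∧ s ∈ Φ₁.1).card = 2)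
    (h23₂ : (Finset.univ.filter fun s : K →+* ℂ => s.comp i = τ ∧ s ∈ Φ₂.1).card = 2) (hne : Φ₁ ≠ Φ₂)
    (h3T : ∀ x y : Fin 3 ↪ {s : K →+* ℂ // s.comp i = τ}, ∃ ρ : ℂ ≃+* ℂ, ∀ j : Fin 3, (ρ : ℂ →+* ℂ).comp (x j).1 = (y j).1)
    (κ : Fin N → Fin 3) :
    HodgeConjectureFor (⨁ fun j => (![E, B₁, B₂] : Fin 3 → AbelianVariety ℂ) (κ j)).dim
      (⨁ fun j => (![E, B₁, B₂] : Fin 3 → AbelianVariety ℂ) (κ j)).X := by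
  have hττ : ComplexEmbedding.conjugate τ ≠ τ := QuarticCM.conjugate_ne τ
  have hk : ∀ σ : k →+* ℂ, σ = τ ∨ σ = ComplexEmbedding.conjugate τ := fun σ =>
    QuarticCM.eq_or_eq_conjugate_of_quadratic h2 τ σ
  have hΨ : ∀ σ : k →+* ℂ, σ ∈ Ψ.1 ↔ σ = τ := by
    intro σ
    rcases hk σ with rfl | rfl
    · exact ⟨fun _ => rfl, fun _ => hτΨ⟩
    · exact ⟨fun h => absurd h ((Ψ.2 τ).1 hτΨ), fun h => absurd h hττ⟩
  -- `√−d ∈ 𝓞_k` with `τ(√−d) = i√d`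
  obtain ⟨δ₀, d, hd, hδ₀⟩ := CyclicSextic.exists_sq_eq_neg_nat_of_isTotallyComplex k h2
  obtain ⟨δ, hδ, hτ⟩ := exists_delta_of_mem h2 hd hδ₀ τ
  -- the frame in normal form
  obtain ⟨e, c, he_sign, he_conj, hr₁, hr₂⟩ := exists_frameD h10 h2 i hττ hk Φ₁ Φ₂ h23₁ h23₂ hne
  have h3t := h3t_of_threeTransitive he_sign h3T
  -- the family `Kf = (k, K)` and the three slots `(k, K, K)`
  let Kf : Fin 2 → Type := Fin.cons k fun _ : Fin 1 => K
  letI instF : ∀ j, Field (Kf j) := fun j =>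
    Fin.cases (motive := fun j => Field (Kf j)) ‹Field k› (fun _ => ‹Field K›) j
  letI instN : ∀ j, NumberField (Kf j) := fun j =>
    Fin.cases (motive := fun j => NumberField (Kf j)) ‹NumberField k› (fun _ => ‹NumberField K›) j
  haveI instC : ∀ j, IsCMField (Kf j) := fun j =>
    Fin.cases (motive := fun j => IsCMField (Kf j)) ‹IsCMField k› (fun _ => ‹IsCMField K›) j
  exact hodgeConjectureFor_biproduct_comp_of_frameD_of_markmanSixfold_h3t (Kf := Kf) (i₀ := 0) (i₁ := 1) (c := c)
    (A₃ := ![E, B₁, B₂])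
    (Φ₃ := Fin.cons Ψ (Fin.cons Φ₁ (Fin.cons Φ₂ finZeroElim)))
    (ι₃ := Fin.cons ιE (Fin.cons ι₁ (Fin.cons ι₂ finZeroElim)))
    (θ₃ := Fin.cons θE (Fin.cons θ₁ (Fin.cons θ₂ finZeroElim))) hM6 κ h10 h2 i hd hδ hτ
    (Fin.cases hE (Fin.cases hB₁ (Fin.cases hB₂ fun l => l.elim0))) e he_sign he_conj
    (Fin.cases hr₁ (Fin.cases hr₂ fun l => l.elim0)) hΨ h3t

/-- **… and for every abelian variety dominated by such a product** (isogeny factors, quotients, abelian subvarieties of some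
`E^a × B₁^{n₁} × B₂^{n₂}`; in particular every power of every abelian variety isogenous to a product of copies of `E, B₁, B₂`).
[cite: Markman2025SecantWeil, Thm 1.5.1] [cite: MumfordAV1970, §19] -/
theorem hodgeConjectureFor_of_avDominatedBy_comp_vec_of_markmanD
    (hM6 : Markman2025_weilClasses_algebraic_hyperbolicSixfold)
    (h10 : Module.finrank ℚ K = 10) (h2 : Module.finrank ℚ k = 2) (i : k →+* K)
    (hB₁ : IsCMTypeRealisation Φ₁ B₁ ι₁ θ₁) (hB₂ : IsCMTypeRealisation Φ₂ B₂ ι₂ θ₂) (hE : IsCMTypeRealisation Ψ E ιE θE)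
    {τ : k →+* ℂ} (hτΨ : τ ∈ Ψ.1)
    (h23₁ : (Finset.univ.filter fun s : K →+* ℂ => s.comp i = τ ∧ s ∈ Φ₁.1).card = 2)
    (h23₂ : (Finset.univ.filter fun s : K →+* ℂ => s.comp i = τ ∧ s ∈ Φ₂.1).card = 2) (hne : Φ₁ ≠ Φ₂)
    (h3T : ∀ x y : Fin 3 ↪ {s : K →+* ℂ // s.comp i = τ}, ∃ ρ : ℂ ≃+* ℂ, ∀ j : Fin 3, (ρ : ℂ →+* ℂ).comp (x j).1 = (y j).1)
    (κ : Fin N → Fin 3) {C : AbelianVariety ℂ}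
    (hC : Domination.AVDominatedBy C (⨁ fun j => (![E, B₁, B₂] : Fin 3 → AbelianVariety ℂ) (κ j))) :
    HodgeConjectureFor C.dim C.X :=
  Domination.hodgeConjectureFor_of_avDominatedBy
    (hodgeConjectureFor_biproduct_comp_vec_of_markmanD hM6 h10 h2 i hB₁ hB₂ hE hτΨ h23₁ h23₂ hne h3T κ) hC

end Main

end Summit.HodgeConjecture.CorCM.DecicWeil23Pair

end
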